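import Summits.Ventures.LatticeQCDFlow.Scoring.SU2TorusPlaquetteCharacterIntegral
import HarnessLib

/-!
# SU(2) on the 2-torus: the Haar integral of a product of plaquette characters WITH A CHARACTER `χ_j(U_{x₀})` INSERTED

HONEST FRAMING: exact (Metropolis-corrected) sampling algorithms for lattice gauge theory;
figures of merit are autocorrelation/cost numbers at stated couplings and volumes; no
continuum-physics claim.

Venture `LatticeQCDFlow` (cell pub-lqcd), sub-topic `Scoring`; FANOUT row 5 (`s0-sun-a`), GEN-13.
NEW WORK of the cell (placement rule).  `Scoring/SU2TorusPlaquetteCharacterIntegral.lean` (GEN-10) inserts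
ONE plaquette trace `a₀ = ½ tr = ½ χ_1` into the torus character integral (`t·U_k = (U_{k+1} + U_{k−1})/2`);
GEN-12 carried 'general moments `⟨χ_j(U_p)⟩`' as NOT TYPED.  This file inserts an arbitrary character
`χ_j = U_j(a₀)`:

* §1 **the Chebyshev–Clebsch–Gordan linearisation** `U_j · U_m = Σ_{i=0}^{j} U_{m+j−2i}` (`j ∈ ℕ`,
  `m ∈ ℤ`; `chebyshevU_natCast_mul`), its evaluated form for `j ≤ m`, and for all `j, m ∈ ℕ` the
  `SU(2)` Clebsch–Gordan series `U_j(t) U_m(t) = Σ_{i=0}^{j} [i ≤ m] U_{j+m−2i}(t)`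
  (`chebyshevU_eval_mul_eq_sum_ite`: the representations `|j−m|, |j−m|+2, …, j+m`);
* §2 `chebyshevU_mul_prod_su2Character` (pointwise) and
  **`integral_chebyshevU_mul_prod_su2Character_plaquettes`**:
  `∫ χ_j(U_{x₀}) ∏_x χ_{m_x}(U_x) dHaar^{⊗E} = Σ_{i=0}^{j} [i ≤ m_{x₀}] I(m^{(i)})`,
  `m^{(i)} = update m x₀ (j + m_{x₀} − 2i)`, `I(m') = [m' constant]·((m'_0+1)^{L²})⁻¹`
  (`SU2TorusCharacterIntegral`).

The companion `Scoring/SU2TorusCharacterMoments.lean` sums the character expansion.  Not in Mathlib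
(which has `T_mul_T` only); elementary; nothing is cited; no `def`.
-/

noncomputable section

open Real MeasureTheory Set Function Finset Polynomial.Chebyshev
open Literature.MathematicalPhysics.QuantumFieldTheory Literature.MathematicalPhysics.QuantumLattice
open Literature.Analysis.FunctionSpaces
open Summit.Ventures.LatticeQCDFlow.Exactness
open Summit.Ventures.LatticeQCDFlow.Theory2.Lattice

namespace Summit.Ventures.LatticeQCDFlow.Scoring

/-! ## §1. The linearisation `U_j U_m = Σ_{i ≤ j} U_{m+j−2i}` -/

/-- **Chebyshev linearisation / `SU(2)` Clebsch–Gordan**, `ℤ`-indexed: for `j ∈ ℕ` and `m ∈ ℤ`,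
`U_j · U_m = Σ_{i=0}^{j} U_{m+j−2i}` (as polynomials; `U_{−1} = 0`, `U_{−n−2} = −U_n`). -/
theorem chebyshevU_natCast_mul (R : Type*) [CommRing R] :
    ∀ (j : ℕ) (m : ℤ), U R (j : ℤ) * U R m = ∑ i ∈ Finset.range (j + 1), U R (m + j - 2 * (i : ℤ))
  | 0, m => by simp
  | 1, m => by
      rw [Finset.sum_range_succ, Finset.sum_range_succ, Finset.sum_range_zero, zero_add]
      have e0 : m + ((1 : ℕ) : ℤ) - 2 * ((0 : ℕ) : ℤ) = m + 1 := by push_cast; ring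
      have e1 : m + ((1 : ℕ) : ℤ) - 2 * ((1 : ℕ) : ℤ) = m - 1 := by push_cast; ring
      rw [e0, e1, Nat.cast_one, U_one, U_add_one]
      ring
  | (j + 2), m => by
      have h1 := chebyshevU_natCast_mul R (j + 1) m
      have h0 := chebyshevU_natCast_mul R j m
      have hrec : U R ((j + 2 : ℕ) : ℤ) = 2 * Polynomial.X * U R ((j + 1 : ℕ) : ℤ) - U R (j : ℤ) := by
        push_cast
        rw [show (j : ℤ) + 2 = (j : ℤ) + 1 + 1 by ring, U_add_one]
        congr 2
        ring
      -- `2X · U_n = U_{n+1} + U_{n−1}`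
      have hX : ∀ n : ℤ, 2 * Polynomial.X * U R n = U R (n + 1) + U R (n - 1) := fun n => by
        rw [U_add_one]; ring
      rw [hrec, sub_mul, mul_assoc, h1, h0, Finset.mul_sum]
      simp_rw [hX]
      rw [Finset.sum_add_distrib]
      -- peel every sum down to `range (j + 1)`
      simp only [show j + 2 + 1 = j + 1 + 1 + 1 from rfl]
      rw [Finset.sum_range_succ (fun i => U R (m + ↑(j + 1) - 2 * (i : ℤ) + 1)),
        Finset.sum_range_succ (fun i => U R (m + ↑(j + 1) - 2 * (i : ℤ) - 1)),
        Finset.sum_range_succ (fun i => U R (m + ↑(j + 2) - 2 * (i : ℤ))),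
        Finset.sum_range_succ (fun i => U R (m + ↑(j + 2) - 2 * (i : ℤ)))]
      have e1 : ∀ i : ℕ, U R (m + ↑(j + 1) - 2 * (i : ℤ) + 1) = U R (m + ↑(j + 2) - 2 * (i : ℤ)) :=
        fun i => by congr 1; push_cast; ring
      have e2 : ∀ i : ℕ, U R (m + ↑(j + 1) - 2 * (i : ℤ) - 1) = U R (m + ↑j - 2 * (i : ℤ)) :=
        fun i => by congr 1; push_cast; ring
      simp_rw [e1, e2]
      have e3 : U R (m + ↑j - 2 * ((j + 1 : ℕ) : ℤ)) = U R (m + ↑(j + 2) - 2 * ((j + 1 + 1 : ℕ) : ℤ)) := by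
        congr 1; push_cast; ring
      rw [e3]
      ring

/-- Evaluated linearisation for `j ≤ m` (natural indices, no negative representation occurs):
`U_j(t) U_m(t) = Σ_{i=0}^{j} U_{j+m−2i}(t)`. -/
theorem chebyshevU_eval_mul_of_le {j m : ℕ} (hjm : j ≤ m) (t : ℝ) :
    (U ℝ j).eval t * (U ℝ m).eval t =
      ∑ i ∈ Finset.range (j + 1), (U ℝ ((j + m - 2 * i : ℕ) : ℤ)).eval t := by
  have h := congrArg (fun p : Polynomial ℝ => p.eval t) (chebyshevU_natCast_mul ℝ j (m : ℤ))
  simp only [Polynomial.eval_mul, Polynomial.eval_finsetSum] at h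
  rw [h]
  refine Finset.sum_congr rfl fun i hi => ?_
  have hi' : i ≤ j := Nat.lt_succ_iff.mp (Finset.mem_range.mp hi)
  congr 2
  have : 2 * i ≤ j + m := by omega
  push_cast [this]
  ring

/-- **The `SU(2)` Clebsch–Gordan series, evaluated**: for all `j, m ∈ ℕ` and real `t`,
`U_j(t) U_m(t) = Σ_{i=0}^{j} [i ≤ m]·U_{j+m−2i}(t)` — the characters of `j ⊗ m = ⊕_{i ≤ min(j,m)} (j+m−2i)`. -/
theorem chebyshevU_eval_mul_eq_sum_ite (j m : ℕ) (t : ℝ) :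
    (U ℝ j).eval t * (U ℝ m).eval t =
      ∑ i ∈ Finset.range (j + 1), (if i ≤ m then (U ℝ ((j + m - 2 * i : ℕ) : ℤ)).eval t else 0) := by
  rcases le_or_gt j m with hjm | hmj
  · rw [chebyshevU_eval_mul_of_le hjm]
    refine Finset.sum_congr rfl fun i hi => ?_
    have hi' : i ≤ j := Nat.lt_succ_iff.mp (Finset.mem_range.mp hi)
    rw [if_pos (hi'.trans hjm)]
  · rw [mul_comm, chebyshevU_eval_mul_of_le hmj.le]
    -- the terms `m < i ≤ j` vanish; the others agree after `j + m = m + j`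
    rw [← Finset.sum_range_add_sum_Ico _ (by omega : m + 1 ≤ j + 1)]
    have hz : ∑ i ∈ Finset.Ico (m + 1) (j + 1),
        (if i ≤ m then (U ℝ ((j + m - 2 * i : ℕ) : ℤ)).eval t else 0) = 0 :=
      Finset.sum_eq_zero fun i hi => by
        rw [Finset.mem_Ico] at hi
        rw [if_neg (by omega)]
    rw [hz, add_zero]
    refine Finset.sum_congr rfl fun i hi => ?_
    have hi' : i ≤ m := Nat.lt_succ_iff.mp (Finset.mem_range.mp hi)
    rw [if_pos hi', Nat.add_comm m j]

/-! ## §2. Inserting `χ_j(U_{x₀})` into the torus character integral -/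

variable {L : ℕ} [NeZero L]

/-- **Inserting a character, pointwise**: with `m^{(i)} = update m x₀ (j + m_{x₀} − 2i)`,
`U_j(t_{x₀})·∏_x U_{m_x}(t_x) = Σ_{i=0}^{j} [i ≤ m_{x₀}]·∏_x U_{m^{(i)}_x}(t_x)`. -/
theorem chebyshevU_mul_prod_su2Character {Ω : Type*} (t : Site 2 L → Ω → ℝ) (m : Site 2 L → ℕ)
    (x₀ : Site 2 L) (j : ℕ) (V : Ω) :
    (U ℝ j).eval (t x₀ V) * ∏ x : Site 2 L, (U ℝ (m x)).eval (t x V) =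
      ∑ i ∈ Finset.range (j + 1), (if i ≤ m x₀ then
        ∏ x : Site 2 L, (U ℝ (update m x₀ (j + m x₀ - 2 * i) x)).eval (t x V) else 0) := by
  rw [← Finset.mul_prod_erase _ _ (Finset.mem_univ x₀), ← mul_assoc, chebyshevU_eval_mul_eq_sum_ite,
    Finset.sum_mul]
  refine Finset.sum_congr rfl fun i _ => ?_
  split_ifs with hi
  · rw [prod_su2Character_update]
  · rw [zero_mul]

/-- **THE CHARACTER-INSERTED INTEGRAL ON THE 2-TORUS.**  For `L ≥ 1`, `m : Λ → ℕ`, a plaquette `x₀`,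
`j ∈ ℕ` and product Haar measure on the links of `(ℤ/L)²`:
`∫ χ_j(U_{x₀})·∏_x χ_{m_x}(U_x) dHaar^{⊗E} = Σ_{i=0}^{j} [i ≤ m_{x₀}]·I(m^{(i)})`,
`m^{(i)} = update m x₀ (j + m_{x₀} − 2i)`, `I(m') = [∀ x, m'_x = m'_0]·((m'_0+1)^{L²})⁻¹`. -/
theorem integral_chebyshevU_mul_prod_su2Character_plaquettes (m : Site 2 L → ℕ) (x₀ : Site 2 L) (j : ℕ) :
    ∫ V, (U ℝ j).eval (su2a0 (plaquetteHolonomy V x₀ 0 1)) *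
        ∏ x : Site 2 L, (U ℝ (m x)).eval (su2a0 (plaquetteHolonomy V x 0 1))
        ∂(Measure.pi fun _ : Edge 2 L => haarProbability (Matrix.specialUnitaryGroup (Fin 2) ℂ)) =
      ∑ i ∈ Finset.range (j + 1), (if i ≤ m x₀ then
        (if (∀ x, update m x₀ (j + m x₀ - 2 * i) x = update m x₀ (j + m x₀ - 2 * i) 0) then
          ((((update m x₀ (j + m x₀ - 2 * i) 0 : ℝ) + 1) ^ (L ^ 2)))⁻¹ else 0) else 0) := by
  simp_rw [chebyshevU_mul_prod_su2Character (fun (x : Site 2 L)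
    (V : GaugeConfig 2 L (Matrix.specialUnitaryGroup (Fin 2) ℂ)) => su2a0 (plaquetteHolonomy V x 0 1)) m x₀ j]
  rw [integral_finsetSum]
  · refine Finset.sum_congr rfl fun i _ => ?_
    by_cases hi : i ≤ m x₀
    · simp only [if_pos hi]
      exact integral_prod_su2Character_plaquettes (update m x₀ (j + m x₀ - 2 * i))
    · simp only [if_neg hi, integral_zero]
  · intro i _
    by_cases hi : i ≤ m x₀
    · simp only [if_pos hi]
      exact integrable_pi_su2_of_continuous (ι := Edge 2 L)
        (continuous_prod_su2Character_plaquettes (update m x₀ (j + m x₀ - 2 * i)))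
    · simp only [if_neg hi]
      exact integrable_zero _ _ _

end Summit.Ventures.LatticeQCDFlow.Scoring
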